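import Summits.ABC.ABC.Theses.IneffectiveSubspace
import Literature.NumberTheory.DiophantineGeometry.AbcDepthCensusTurboMixed

/-!
# `DeepRegimeABC` (stmt-ABC-15121): certified census — the first member of the cell `ω₅ ≥ 9`, chunk run (H: the inhabited chunk)

Compute-certificate (line lead `prover-line-stmt-ABC-15121-c3-0`, 2026-08-16; human certificate
objective) for the crux `Summit.ABC.ABC.Theses.IneffectiveSubspace.DeepRegimeABC`, with the symmetric turbo
checker `checkTurboChunkSym` (`AbcDepthCensusTurboSym.lean`) and the member test `memberTest`
(`AbcDepthCensusTurboMixed.lean`).  The census of the cell `ω₅ ≥ 9` in the box `c ≤ 10¹⁹` over the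
13-chunk cover `S₁₃` found twelve chunks without any lattice candidate (`…CensusCellNine19{A–G,I}.lean` and
the four small chunks of `…J.lean`, always-failing test) and ONE inhabited chunk, `[3, 2]`: its single
candidate is coprime — the first member of the cell,

  `1988126811413284375 + 7841883220216632873 = 9830010031629917248`,
  `5⁵·19⁵·31·661·12539 + 3⁵·11⁵·13⁵·539677 = 2⁶·7⁵·17⁵·23⁵`,

`ω₅ = 9` with the first nine primes `2, …, 23` all deep, quality `0.8445` (found when the always-failing run of
this chunk was refused by the gate: `native_decide` evaluated it to `false`; confirmed by the C mirror).

**Certified here** (file H): chunk `[3, 2]` (16 808 743 patterns) accepts the member test of this single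
triple — every coprime candidate of the chunk is it (in one of the two orientations).  Consumed by
`…CensusCellNine19J.lean` (`members_complete_of_mixed`).  The only computation trusted to the compiler is this
closed `Bool` equation (`native_decide`, computational certificate lane).
-/

-- `Summit.<Summit>.<Problem>` is the mandated summit-side namespace (CONVENTIONS §2); for the
-- single-conjunct summit `ABC` the two coincide, so the duplicate `ABC.ABC` is deliberate.
set_option linter.dupNamespace false

namespace Summit.ABC.ABC.Theorems.DeepRegimeABC

open Literature.NumberTheory.DiophantineGeometry
open Literature.NumberTheory.DiophantineGeometry.DepthCensus

/-! ## The compiled chunk run of this file -/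

/-- Chunk `[3, 2]` of the cell `ω₅ ≥ 9` in the box `c ≤ 10¹⁹` (16 808 743 patterns, 180 575 058 outer steps): every
coprime candidate is `(1988126811413284375, 7841883220216632873, 9830010031629917248)` — **registered run stub
`censusCellNine19RunsH2`** (crux `DeepRegimeABC`, line SketchIdeator5R2), consumed by `…CensusCellNine19J.lean`.
[folklore] -/
theorem censusCellNine19RunsH2 : Literature.NumberTheory.DiophantineGeometry.DepthCensus.checkTurboChunkSym (10 ^ 19) 6309 9 [3, 2] (Literature.NumberTheory.DiophantineGeometry.DepthCensus.memberTest [(1988126811413284375, 7841883220216632873, 9830010031629917248)]) = true := by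
  native_decide

end Summit.ABC.ABC.Theorems.DeepRegimeABC
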